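/-
Copyright (c) 2026 the pub-hodgecm-mathlib formalisation cell (harness21).  Prover seat hodgecm-mathlib-LH7-p09 (g0), re-dealt by director s1969 (a) to strike line L3
`stub_N6nsDyadic` (Track A «(D-RAM) FOUR-FRAME» squad F0∕P3c∕LH4; heir LEAD F0P3a-plan (g21), β sub-dealer LH4-p05 (g8)); helper lane on h413 = stmt-HodgeConjecture-24833
(count-neutral).  The `q = 2` companion of ★ p861173 ∕ ★ p861198 (TOWER-SIGN RELATIONS I–III): the SHALLOW isosceles keys `L − m = 2d − 2`.  2026-09-04.
-/
import Summits.HodgeConjecture.HodgeConjecture.Theorems.F0P3cDyRamTowerSignRelationsDeep       -- ★ p861198 (LH7-p08 (g0)): RELATIONS II∕III; brings ★ p861173 RELATION I, ★ tokens, `mstarOfRecord`, ★ `WildQuadraticDatumNormSignConductor`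
import Summits.HodgeConjecture.HodgeConjecture.Theorems.F0P3cDyRamCoreHangingEmptyOfCardTwo     -- ★ p861224 (this seat): the `q = 2` digit `v_sub_lt_of_v_sub_one_eq_of_card_two`
import Literature.NumberTheory.LocalFields.WildQuadraticDatumNormOneQuotient                    -- ★ `two_le_of_v_two_lt_one` (`|2| < 1 ⇒ d ≥ 2`)
import HarnessLib

/-!
# Crux `H413`, line LH4 «(D-RAM) FOUR-FRAME» — TOWER-SIGN RELATIONS AT THE SHALLOW KEYS WHEN `q = 2`: on an isosceles key `(m, m, L)` with `L − m = 2d − 2` and a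
# two-element residue field, the two equal-depth towers carry OPPOSITE signs (`ω_B = −ω_A`; likewise `ω_C = −ω_B`, `ω_C = −ω(−1)·ω_A` on the other two keys)

Cell `hodgecm-mathlib` (D-0151), FLOOR 0, crux item H413 = `stmt-HodgeConjecture-24833`, route `HCCMUnconditional`; squad F0∕P3c∕LH4.  THEOREMS ONLY (no `def`, no instance, no
notation, no `sorry`, default heartbeats); ★-only imports; lane `--supports stmt-HodgeConjecture-24833 --as helper`; pays NO row, states NO law.

WHY.  ★ RELATION I (`F0P3cDyRamTowerSignRelations.normSign_towerSign_eq_of_sub_deep`, LH4-p05 (g8)) and ★ RELATIONS II∕III (`F0P3cDyRamTowerSignRelationsDeep`, LH7-p08 (g0))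
settle the tower-sign tokens of a DEEP isosceles key `L − m ≥ 2d − 1` (the two equal-depth tokens agree to conductor precision, ★ `normSign_eq_of_near`), and leave the SHALLOW
keys `L − m ≤ 2d − 2` open: «there the relation is a genuine datum — forced at `q = 2`, free at `q ≥ 4` where the H-row pays» (F0P3a-p01 (g37) ODDBOX-ORACLE v1 §3; LH7-p08
H-ROW-DERIVATION v1: «`ψ₀(1) = −1` is FORCED on `𝔽₂`»).  THIS FILE proves the forced case.  At `q = 2` every unit reduces to `1`, so any two σ-fixed units `c, c₀` with
`|c − 1| = |c₀ − 1| = |ϖ|^{2(d−1)}` EXACTLY satisfy `|c − c₀| < |ϖ|^{2(d−1)}` (★ p861224 `v_sub_lt_of_v_sub_one_eq_of_card_two`), hence — fixed elements having EVEN valuation —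
`|c − c₀| ≤ |ϖ|^{2d}`, within conductor precision: `ω(c) = ω(c₀)` (★ `normSign_eq_of_near`).  Taking for `c₀` the non-norm of ★ `exists_fixed_unit_not_norm_v_sub_one_le`
(`|c₀ − 1| ≤ |ϖ|^{2(d−1)}`, necessarily EXACT since `U_F(2d−1)` consists of norms, ★ `normSign_eq_one_of_fixed_of_v_sub_one_le`): §1 **the whole shell `|c − 1| = |ϖ|^{2(d−1)}`
consists of NON-NORMS at `q = 2`** (`normSign σ c = −1`).  §2 On the shallow key `L + 2 = n + 2d` the congruence argument of ★ RELATION I shows that the two tokens `e` (of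
`α − 1`) and `e'` (of `β − 1`) at depth `n` satisfy `|e − e'| = |ϖ|^{2(d−1)}` EXACTLY (the term `(β − α)·π^{−k}∕(ϖ^{m*}·t₊)` now has valuation `|ϖ|⁻¹ > 1` and dominates), so
`e'∕e` lies on the shell of §1: **RELATION I′ `normSign σ e' = −normSign σ e`** (★ `normSign_mul_of_fixed`); II′, III′ by LH7-p08's substitutions `(α, β) ↦ (β−α+1, β)`,
`(2−α, β−α+1)`.  §3 the three relations in ELEMENT-DATUM form on the shallow keys `n₁ = n₂, n₁ + 2d = n₃ + 2` (`ω_B = −ω_A`), `n₁ = n₃, n₁ + 2d = n₂ + 2` (`ω_C = −ω_B`),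
`n₂ = n₃, n₂ + 2d = n₁ + 2` (`ω_C = −ω(−1)·ω_A`) — the (T1) v0 `hrel0` shapes at general `d`, each token at its own depth letter as ★ p860780 `heA`∕`heB` ∕ ★ p860907 `heC`
bind it.  CONSUMER: the `hRest` ∕ `restTarget` assembly of the (β) table at `q = 2` on the keys `s_g = 2d − 2`, where `restTarget = −(σ_Y[o] + σ_Z[o])∕2·q^{m−ℓ₀−1}` must
vanish with no H stratum to pay it (★ p861224: H is empty at `q = 2`; LH4-cdis1 (g0) KAPPA-CLASS-RULE v1 9469d3b1: «at `s_g = 2d−2` both totals vanish at `q = 2` by the forced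
token relation») — by §3, `σ_Y[o] = −σ_Z[o]` there.
HONEST LABEL.  Count-neutral arithmetic helper; table∕(β-BAL)∕(β)∕T₊ row OPEN; `HC_CM` is proved only modulo the 7 printed citations (2 remaining named inputs: hLiu418 =
`stmt-HodgeConjecture-24832`, h413 = `stmt-HodgeConjecture-24833`) until rung 0 closes.  Nothing printed is asserted.

## References
* [Serre1979] J.-P. Serre, *Local Fields*, GTM 67 (1979), Ch. V §3 Prop. 5, Cor. 2–3 (norm groups and conductor of a ramified quadratic extension); Ch. XV §2.
* [Rogawski1990] J. D. Rogawski, *Automorphic Representations of Unitary Groups in Three Variables*, Ann. of Math. Stud. 123 (1990), §4.9 p. 55.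
-/

set_option autoImplicit false

noncomputable section

namespace Summit.HodgeConjecture.HodgeConjecture.Cruxes.H413.F0P3cDyRamTowerSignRelationsShallowCardTwo

open Literature.NumberTheory.Automorphic Literature.NumberTheory.Automorphic.UnitaryThreeFourFrame
open Literature.NumberTheory.LocalFields Literature.NumberTheory.LocalFields.WildQuadraticDatum
open Summit.HodgeConjecture.HodgeConjecture.Cruxes.H413.F0P3cDyRamFourFramePieces
open Summit.HodgeConjecture.HodgeConjecture.Cruxes.H413.F0P3cDyRamStageOneBDefs
open Summit.HodgeConjecture.HodgeConjecture.Cruxes.H413.F0P3cDyRamTowerSignToken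
open Summit.HodgeConjecture.HodgeConjecture.Cruxes.H413.F0P3cDyRamTowerSignRelations
open Summit.HodgeConjecture.HodgeConjecture.Cruxes.H413.F0P3cDyRamTowerSignRelationsDeep
open Summit.HodgeConjecture.HodgeConjecture.Cruxes.H413.F0P3cDyRamCoreHangingEmptyOfCardTwo (v_sub_lt_of_v_sub_one_eq_of_card_two)
open WithZero
open scoped Valued

variable {K : Type} [Field K] [Valued K ℤᵐ⁰]

/-! ## §1  At `q = 2` the shell `|c − 1| = |ϖ|^{2(d−1)}` of fixed units consists of non-norms -/

/-- **FIXED ELEMENTS HAVE EVEN VALUATION, SO A STRICT INEQUALITY AT AN EVEN LEVEL GAINS TWO**: `σ x = x`, `x ≠ 0`, `|x| < |ϖ|^{2k}` ⇒ `|x| ≤ |ϖ|^{2k+2}`.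
[cite: Serre1979, Ch. V §3 Prop. 5, Cor. 2–3] -/
theorem v_le_pow_add_two_of_fixed_of_lt {σ : K →+* K} {ϖ : K}
    (hfix : ∀ x : K, σ x = x → x ≠ 0 → ∃ n : ℤ, Valued.v x = exp (2 * n)) (hϖ : Valued.v ϖ = exp (-1 : ℤ))
    {x : K} (hσx : σ x = x) (hx0 : x ≠ 0) {k : ℕ} (hlt : Valued.v x < Valued.v ϖ ^ (2 * k)) :
    Valued.v x ≤ Valued.v ϖ ^ (2 * k + 2) := by
  obtain ⟨j, hj⟩ := hfix x hσx hx0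
  rw [hj, v_varpi_pow hϖ, exp_lt_exp] at hlt
  rw [hj, v_varpi_pow hϖ, exp_le_exp]
  push_cast at hlt ⊢
  omega

/-- **THE `q = 2` NON-NORM SHELL.**  At a ramified datum `(σ, ϖ, d, t)` on a complete field with `|2| < 1` and a TWO-element residue field, every σ-fixed `c` with
`|c − 1| = |ϖ|^{2(d−1)}` EXACTLY is a non-norm: `normSign σ c = −1`.  (★ `exists_fixed_unit_not_norm_v_sub_one_le` gives a non-norm `c₀` on or below this shell; it is ON the
shell because `U_F(2d−1)` consists of norms (★ `normSign_eq_one_of_fixed_of_v_sub_one_le`); and at `q = 2` two fixed units on the same shell agree to precision `|ϖ|^{2d}` —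
★ p861224 `v_sub_lt_of_v_sub_one_eq_of_card_two` plus evenness — so `ω(c) = ω(c₀)` by ★ `normSign_eq_of_near`.)  LH7-p08 (g0)'s «`ψ₀(1) = −1` is forced on `𝔽₂`».
[cite: Serre1979, Ch. V §3 Prop. 5, Cor. 2–3; Ch. XV §2] -/
theorem normSign_eq_neg_one_of_v_sub_one_eq_of_card_two [CompleteSpace K] [Fintype 𝓀[K]] {σ : K →+* K} {ϖ : K} {d t : ℕ}
    (hD : IsRamifiedQuadraticDatum σ ϖ d t) (h2v : Valued.v (2 : K) < 1) (hq : Fintype.card 𝓀[K] = 2)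
    {c : K} (hσc : σ c = c) (hc : Valued.v (c - 1) = Valued.v ϖ ^ (2 * (d - 1))) : normSign σ c = -1 := by
  obtain ⟨hσ, hvσ, hϖ, hfix, hd, h1d, ht⟩ := id hD
  have hϖ0 : ϖ ≠ 0 := fun h => by rw [h, map_zero] at hϖ; exact (coe_ne_zero hϖ.symm).elim
  have hϖle : Valued.v ϖ ≤ 1 := by rw [hϖ, ← exp_zero, exp_le_exp]; norm_num
  have hodd : 2 * (d - 1) + 2 = (2 * d - 1) + 1 := by omega
  -- the reference non-norm `c₀` on or below the shell
  obtain ⟨c₀, hσc₀, hc₀1, hc₀le, hc₀n⟩ := exists_fixed_unit_not_norm_v_sub_one_le hD h2v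
  have hc₀le' : Valued.v (c₀ - 1) ≤ Valued.v ϖ ^ (2 * (d - 1)) := by
    rw [v_varpi_pow hϖ]; push_cast; exact hc₀le
  have hω₀ : normSign σ c₀ = -1 := normSign_of_not_isNorm σ hc₀n
  -- `c₀` is ON the shell: otherwise `|c₀ − 1| ≤ |ϖ|^{2d} ≤ |ϖ|^{2d−1}` and `c₀` would be a norm
  have hc₀eq : Valued.v (c₀ - 1) = Valued.v ϖ ^ (2 * (d - 1)) := by
    by_contra hne
    have hlt : Valued.v (c₀ - 1) < Valued.v ϖ ^ (2 * (d - 1)) := lt_of_le_of_ne hc₀le' hne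
    have hσc₀1 : σ (c₀ - 1) = c₀ - 1 := by rw [map_sub, hσc₀, map_one]
    have hle : Valued.v (c₀ - 1) ≤ Valued.v ϖ ^ (2 * d - 1) := by
      by_cases h0 : c₀ - 1 = 0
      · rw [h0, map_zero]; exact zero_le
      · exact (v_le_pow_add_two_of_fixed_of_lt hfix hϖ hσc₀1 h0 hlt).trans
          (by rw [hodd]; exact pow_le_pow_right_of_le_one' hϖle (Nat.le_succ _))
    have h1 : normSign σ c₀ = 1 := normSign_eq_one_of_fixed_of_v_sub_one_le hD hσc₀ le_rfl hle
    rw [h1] at hω₀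
    exact absurd hω₀ (by decide)
  -- `c` agrees with `c₀` to precision `|ϖ|^{2d−1}`
  by_cases hcc : c = c₀
  · rw [hcc]; exact hω₀
  have hlt : Valued.v (c - c₀) < Valued.v ϖ ^ (2 * (d - 1)) := v_sub_lt_of_v_sub_one_eq_of_card_two hq hϖ0 hc hc₀eq
  have hσcc : σ (c - c₀) = c - c₀ := by rw [map_sub, hσc, hσc₀]
  have hle : Valued.v (c₀ - c) ≤ Valued.v ϖ ^ (2 * d - 1) := by
    rw [Valuation.map_sub_swap]
    exact (v_le_pow_add_two_of_fixed_of_lt hfix hϖ hσcc (sub_ne_zero.2 hcc) hlt).trans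
      (by rw [hodd]; exact pow_le_pow_right_of_le_one' hϖle (Nat.le_succ _))
  rw [normSign_eq_of_near hD hσc₀ hσc hc₀1 le_rfl hle, hω₀]

/-- **UNIT-RATIO FORM**: at `q = 2`, two σ-fixed units `e, e'` with `|e − e'| = |ϖ|^{2(d−1)}` EXACTLY have OPPOSITE norm signs, `normSign σ e' = −normSign σ e`
(§1 on `e'∕e`, ★ `normSign_mul_of_fixed`). [cite: Serre1979, Ch. V §3 Prop. 5, Cor. 2–3; Ch. XV §2] -/
theorem normSign_eq_neg_of_v_sub_eq_of_card_two [CompleteSpace K] [Fintype 𝓀[K]] {σ : K →+* K} {ϖ : K} {d t : ℕ}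
    (hD : IsRamifiedQuadraticDatum σ ϖ d t) (h2v : Valued.v (2 : K) < 1) (hq : Fintype.card 𝓀[K] = 2)
    {e e' : K} (hσe : σ e = e) (he1 : Valued.v e = 1) (hσe' : σ e' = e') (he'0 : e' ≠ 0)
    (hee : Valued.v (e - e') = Valued.v ϖ ^ (2 * (d - 1))) : normSign σ e' = -normSign σ e := by
  have he0 : e ≠ 0 := fun h => by rw [h, map_zero] at he1; exact zero_ne_one he1
  have hσq : σ (e' / e) = e' / e := by rw [map_div₀, hσe, hσe']
  have hq0 : e' / e ≠ 0 := div_ne_zero he'0 he0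
  have hcq : Valued.v (e' / e - 1) = Valued.v ϖ ^ (2 * (d - 1)) := by
    rw [div_sub_one he0, map_div₀, he1, div_one, Valuation.map_sub_swap, hee]
  have hω := normSign_eq_neg_one_of_v_sub_one_eq_of_card_two hD h2v hq hσq hcq
  have e_eq : e' = e' / e * e := (div_mul_cancel₀ e' he0).symm
  rw [e_eq, normSign_mul_of_fixed hD hσq hσe hq0 he0, hω, neg_one_mul]

/-! ## §2  RELATION I′: the two equal-depth tower tokens of a SHALLOW isosceles key (`L − n = 2d − 2`) carry opposite signs at `q = 2` -/

/-- **RELATION I′ — TOWER SIGNS ARE OPPOSITE ACROSS A SHALLOW ISOSCELES PAIR AT `q = 2`.**  At a ramified datum on a complete field with `|2| < 1` and a two-element residue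
field, let `e`, `e'` be tower-sign tokens (σ-fixed, `e` a unit, the `ϖ^{m*}`-congruences of ★ `F0P3cDyRamTowerSignToken` §1 — VERBATIM the letters of ★ RELATION I) of `α − 1` and
`β − 1` at the SAME depth parameter `n ≡ d (mod 2)`, and suppose `|β − α| = |ϖ|^L` EXACTLY with `L + 2 = n + 2d`.  Then `normSign σ e' = −normSign σ e`: the two tokens differ
by `(β − α)·π^{−(n−ℓ₀)∕2}∕t₊` up to `O(ϖ^{m*−ℓ₀})`, and this term now has valuation EXACTLY `2d − 2` — one step short of the conductor — so `|e − e'| = |ϖ|^{2(d−1)}` and §1 applies.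
(Isosceles key `(m, m, L)` with `L − m = 2d − 2`; at `q ≥ 4` the relation is free — ODDBOX-ORACLE §3.) [cite: Serre1979, Ch. V §3 Prop. 5, Cor. 2–3] [cite: Rogawski1990, §4.9 p. 55] -/
theorem normSign_towerSign_eq_neg_of_sub_shallow_of_card_two [CompleteSpace K] [Fintype 𝓀[K]] {σ : K →+* K} {ϖ : K} {d t : ℕ}
    (hD : IsRamifiedQuadraticDatum σ ϖ d t) (h2v : Valued.v (2 : K) < 1) (hq : Fintype.card 𝓀[K] = 2)
    {α β : K} {n L : ℕ} (hvβα : Valued.v (β - α) = Valued.v ϖ ^ L) (hL : L + 2 = n + 2 * d) (hpar : n % 2 = d % 2)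
    {e e' : K} (hσe : σ e = e) (he1 : Valued.v e = 1) (hσe' : σ e' = e')
    (he : Valued.v ((ϖ ^ mstarOfRecord d)⁻¹ * ((α - 1) * ((ϖ * σ ϖ) ^ ((n - d % 2) / 2))⁻¹ - e * ((ϖ - σ ϖ) * ((ϖ * σ ϖ) ^ ((d - d % 2) / 2))⁻¹))) ≤ 1)
    (he' : Valued.v ((ϖ ^ mstarOfRecord d)⁻¹ * ((β - 1) * ((ϖ * σ ϖ) ^ ((n - d % 2) / 2))⁻¹ - e' * ((ϖ - σ ϖ) * ((ϖ * σ ϖ) ^ ((d - d % 2) / 2))⁻¹))) ≤ 1) :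
    normSign σ e' = -normSign σ e := by
  obtain ⟨hσ, hvσ, hϖ, hfix, hd, h1d, ht⟩ := id hD
  have hϖ0 : ϖ ≠ 0 := fun h => by rw [h, map_zero] at hϖ; exact (coe_ne_zero hϖ.symm).elim
  have hvϖ0 : Valued.v ϖ ≠ 0 := (Valuation.ne_zero_iff _).2 hϖ0
  have h2d : 2 ≤ d := two_le_of_v_two_lt_one hσ hvσ hfix hϖ hd ht h2v
  obtain ⟨k, hnk⟩ : ∃ k : ℕ, n = 2 * k + d % 2 := ⟨n / 2, by omega⟩
  have hk : (n - d % 2) / 2 = k := by omega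
  rw [hk] at he he'
  set P : K := ((ϖ * σ ϖ) ^ k)⁻¹ with hPdef
  set tp : K := (ϖ - σ ϖ) * ((ϖ * σ ϖ) ^ ((d - d % 2) / 2))⁻¹ with htpdef
  set M : K := (ϖ ^ mstarOfRecord d)⁻¹ with hMdef
  have htp0 : tp ≠ 0 := refSkewScalar_ne_zero hvσ hϖ hd
  have hvtp : Valued.v tp = Valued.v ϖ ^ (d % 2) := by rw [htpdef, v_refSkewScalar hvσ hϖ hd, v_varpi_pow hϖ]
  have hvP : Valued.v P = (Valued.v ϖ ^ (2 * k))⁻¹ := by rw [hPdef, map_inv₀, map_pow, map_mul, hvσ, ← pow_two, ← pow_mul]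
  have hvM : Valued.v M = (Valued.v ϖ ^ mstarOfRecord d)⁻¹ := by rw [hMdef, map_inv₀, map_pow]
  have hM0 : M ≠ 0 := by rw [hMdef]; exact inv_ne_zero (pow_ne_zero _ hϖ0)
  -- the congruence identity of ★ RELATION I
  have hid : M * ((e - e') * tp) = (-(M * ((α - 1) * P - e * tp)) + M * ((β - 1) * P - e' * tp)) - M * ((β - α) * P) := by ring
  have h12 : Valued.v (-(M * ((α - 1) * P - e * tp)) + M * ((β - 1) * P - e' * tp)) ≤ 1 := by
    refine (Valuation.map_add _ _ _).trans (max_le ?_ he')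
    rw [Valuation.map_neg]; exact he
  -- at the shallow key the third term is LARGE: `|M·(β−α)·P| = |ϖ|⁻¹ > 1`
  have h3 : Valued.v (M * ((β - α) * P)) = (Valued.v ϖ)⁻¹ := by
    rw [map_mul, map_mul, hvM, hvβα, hvP, v_varpi_pow hϖ, v_varpi_pow hϖ, v_varpi_pow hϖ, hϖ, ← exp_neg, ← exp_neg, ← exp_neg, ← exp_add, ← exp_add]
    congr 1
    have hm : mstarOfRecord d = 2 * d - 1 + d % 2 := by unfold mstarOfRecord; omega
    rw [hm]; push_cast; omega
  have h3gt : 1 < Valued.v (M * ((β - α) * P)) := by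
    rw [h3, hϖ, ← exp_neg, ← exp_zero, exp_lt_exp]; norm_num
  -- hence `|M·(e−e')·t₊| = |ϖ|⁻¹` (the small part is swallowed)
  have htot : Valued.v (M * ((e - e') * tp)) = (Valued.v ϖ)⁻¹ := by
    rw [hid, Valuation.map_sub_eq_of_lt_right _ (lt_of_le_of_lt h12 h3gt), h3]
  -- unfold: `|e − e'| = |ϖ|^{m*}·|ϖ|^{−ℓ₀}·|ϖ|⁻¹ = |ϖ|^{2(d−1)}`
  have hee : Valued.v (e - e') = Valued.v ϖ ^ (2 * (d - 1)) := by
    have e1 : e - e' = ϖ ^ mstarOfRecord d * tp⁻¹ * (M * ((e - e') * tp)) := by rw [hMdef]; field_simp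
    rw [e1, map_mul, map_mul, map_inv₀, htot, hvtp, map_pow, v_varpi_pow hϖ, v_varpi_pow hϖ, v_varpi_pow hϖ, hϖ, ← exp_neg, ← exp_neg,
      ← exp_add, ← exp_add]
    congr 1
    have hm : mstarOfRecord d = 2 * d - 1 + d % 2 := by unfold mstarOfRecord; omega
    rw [hm]; push_cast; omega
  -- `e'` is a unit too (`|e − e'| < 1 = |e|`), hence non-zero
  have he'0 : e' ≠ 0 := by
    intro h0
    rw [h0, sub_zero, he1] at hee
    have hlt : Valued.v ϖ ^ (2 * (d - 1)) < 1 := by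
      rw [v_varpi_pow hϖ, ← exp_zero, exp_lt_exp]; push_cast; omega
    exact absurd hee (ne_of_gt hlt)
  exact normSign_eq_neg_of_v_sub_eq_of_card_two hD h2v hq hσe he1 hσe' he'0 hee

/-- **RELATION II′ — `ω(e_C) = −ω(e_B)` AT `q = 2` WHEN `α − 1` IS SHALLOW BY ONE STEP** (`|α − 1| = |ϖ|^L` exactly, `L + 2 = n + 2d`): ★-style substitution `(α, β) ↦ (β−α+1, β)`
in RELATION I′ (roots `β − α` and `β − 1`, difference `α − 1`).  Isosceles key `(m, L, m)`, `L − m = 2d − 2`. [cite: Serre1979, Ch. V §3 Prop. 5, Cor. 2–3] [cite: Rogawski1990, §4.9 p. 55] -/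
theorem normSign_towerSign_sub_eq_neg_of_fst_shallow_of_card_two [CompleteSpace K] [Fintype 𝓀[K]] {σ : K →+* K} {ϖ : K} {d t : ℕ}
    (hD : IsRamifiedQuadraticDatum σ ϖ d t) (h2v : Valued.v (2 : K) < 1) (hq : Fintype.card 𝓀[K] = 2)
    {α β : K} {n L : ℕ} (hvα : Valued.v (α - 1) = Valued.v ϖ ^ L) (hL : L + 2 = n + 2 * d) (hpar : n % 2 = d % 2)
    {eB eC : K} (hσeB : σ eB = eB) (hσeC : σ eC = eC) (heC1 : Valued.v eC = 1)
    (heB : Valued.v ((ϖ ^ mstarOfRecord d)⁻¹ * ((β - 1) * ((ϖ * σ ϖ) ^ ((n - d % 2) / 2))⁻¹ - eB * ((ϖ - σ ϖ) * ((ϖ * σ ϖ) ^ ((d - d % 2) / 2))⁻¹))) ≤ 1)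
    (heC : Valued.v ((ϖ ^ mstarOfRecord d)⁻¹ * ((β - α) * ((ϖ * σ ϖ) ^ ((n - d % 2) / 2))⁻¹ - eC * ((ϖ - σ ϖ) * ((ϖ * σ ϖ) ^ ((d - d % 2) / 2))⁻¹))) ≤ 1) :
    normSign σ eC = -normSign σ eB := by
  have hv : Valued.v (β - (β - α + 1)) = Valued.v ϖ ^ L := by
    have h : β - (β - α + 1) = α - 1 := by ring
    rw [h]; exact hvα
  have heC' : Valued.v ((ϖ ^ mstarOfRecord d)⁻¹ *
      ((β - α + 1 - 1) * ((ϖ * σ ϖ) ^ ((n - d % 2) / 2))⁻¹ - eC * ((ϖ - σ ϖ) * ((ϖ * σ ϖ) ^ ((d - d % 2) / 2))⁻¹))) ≤ 1 := by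
    have h : β - α + 1 - 1 = β - α := by ring
    rw [h]; exact heC
  have hI := normSign_towerSign_eq_neg_of_sub_shallow_of_card_two hD h2v hq hv hL hpar hσeC heC1 hσeB heC' heB
  rw [hI, neg_neg]

/-- **RELATION III′ — `ω(e_C) = −ω(−1)·ω(e_A)` AT `q = 2` WHEN `β − 1` IS SHALLOW BY ONE STEP** (`|β − 1| = |ϖ|^L` exactly, `L + 2 = n + 2d`): substitution `(α, β) ↦ (2−α, β−α+1)`
with first token `−eA` in RELATION I′ (roots `1 − α`, `β − α`, difference `β − 1`), then ★ `normSign_mul_of_fixed`.  Isosceles key `(L, m, m)`, `L − m = 2d − 2`.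
[cite: Serre1979, Ch. V §3 Prop. 5, Cor. 2–3] [cite: Rogawski1990, §4.9 p. 55] -/
theorem normSign_towerSign_sub_eq_neg_mul_of_snd_shallow_of_card_two [CompleteSpace K] [Fintype 𝓀[K]] {σ : K →+* K} {ϖ : K} {d t : ℕ}
    (hD : IsRamifiedQuadraticDatum σ ϖ d t) (h2v : Valued.v (2 : K) < 1) (hq : Fintype.card 𝓀[K] = 2)
    {α β : K} {n L : ℕ} (hvβ : Valued.v (β - 1) = Valued.v ϖ ^ L) (hL : L + 2 = n + 2 * d) (hpar : n % 2 = d % 2)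
    {eA eC : K} (hσeA : σ eA = eA) (heA1 : Valued.v eA = 1) (hσeC : σ eC = eC)
    (heA : Valued.v ((ϖ ^ mstarOfRecord d)⁻¹ * ((α - 1) * ((ϖ * σ ϖ) ^ ((n - d % 2) / 2))⁻¹ - eA * ((ϖ - σ ϖ) * ((ϖ * σ ϖ) ^ ((d - d % 2) / 2))⁻¹))) ≤ 1)
    (heC : Valued.v ((ϖ ^ mstarOfRecord d)⁻¹ * ((β - α) * ((ϖ * σ ϖ) ^ ((n - d % 2) / 2))⁻¹ - eC * ((ϖ - σ ϖ) * ((ϖ * σ ϖ) ^ ((d - d % 2) / 2))⁻¹))) ≤ 1) :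
    normSign σ eC = -(normSign σ (-1 : K) * normSign σ eA) := by
  have hv : Valued.v (β - α + 1 - (2 - α)) = Valued.v ϖ ^ L := by
    have h : β - α + 1 - (2 - α) = β - 1 := by ring
    rw [h]; exact hvβ
  have hσeA' : σ (-eA) = -eA := by rw [map_neg, hσeA]
  have heA1' : Valued.v (-eA) = 1 := by rw [Valuation.map_neg, heA1]
  have heA' : Valued.v ((ϖ ^ mstarOfRecord d)⁻¹ *
      ((2 - α - 1) * ((ϖ * σ ϖ) ^ ((n - d % 2) / 2))⁻¹ - -eA * ((ϖ - σ ϖ) * ((ϖ * σ ϖ) ^ ((d - d % 2) / 2))⁻¹))) ≤ 1 := by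
    have h : (ϖ ^ mstarOfRecord d)⁻¹ * ((2 - α - 1) * ((ϖ * σ ϖ) ^ ((n - d % 2) / 2))⁻¹ - -eA * ((ϖ - σ ϖ) * ((ϖ * σ ϖ) ^ ((d - d % 2) / 2))⁻¹)) =
        -((ϖ ^ mstarOfRecord d)⁻¹ * ((α - 1) * ((ϖ * σ ϖ) ^ ((n - d % 2) / 2))⁻¹ - eA * ((ϖ - σ ϖ) * ((ϖ * σ ϖ) ^ ((d - d % 2) / 2))⁻¹))) := by ring
    rw [h, Valuation.map_neg]; exact heA
  have heC' : Valued.v ((ϖ ^ mstarOfRecord d)⁻¹ *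
      ((β - α + 1 - 1) * ((ϖ * σ ϖ) ^ ((n - d % 2) / 2))⁻¹ - eC * ((ϖ - σ ϖ) * ((ϖ * σ ϖ) ^ ((d - d % 2) / 2))⁻¹))) ≤ 1 := by
    have h : β - α + 1 - 1 = β - α := by ring
    rw [h]; exact heC
  have hI := normSign_towerSign_eq_neg_of_sub_shallow_of_card_two hD h2v hq hv hL hpar hσeA' heA1' hσeC heA' heC'
  have hσ1 : σ (-1 : K) = -1 := by rw [map_neg, map_one]
  have heA0 : eA ≠ 0 := fun h => by rw [h, map_zero] at heA1; exact zero_ne_one heA1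
  rw [hI, ← neg_one_mul eA, normSign_mul_of_fixed hD hσ1 hσeA (neg_ne_zero.2 one_ne_zero) heA0]

/-! ## §3  The three relations in ELEMENT-DATUM form on the SHALLOW keys, each token at its own depth letter (the (T1) v0 `hrel0` shapes at general `d`, `q = 2`) -/

section ElementDatum

variable [CompleteSpace K] [Fintype 𝓀[K]] {σ : K →+* K} {ϖ : K} {d t : ℕ} {α β : K} {N₀ n₁ n₂ n₃ : ℕ}

/-- **`ω_B = −ω_A` AT `q = 2` on the shallow key `n₁ = n₂`, `n₁ + 2d = n₃ + 2`.**  For an element datum `(α, β; n₁, n₂, n₃)` (so `|α − β| = |ϖ|^{n₃}`), tokens `eA` of `α − 1`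
at depth `n₂` and `eB` of `β − 1` at depth `n₁` (★ p860780 `heA` ∕ `heB` verbatim), `n₁ = n₂ ≡ d (mod 2)`: `normSign σ eB = −normSign σ eA` — §2 RELATION I′.
[cite: Serre1979, Ch. V §3 Prop. 5, Cor. 2–3] [cite: Rogawski1990, §4.9 p. 55] -/
theorem normSign_towerSign_eq_neg_of_isElementDatum_of_shallow₃ (hD : IsRamifiedQuadraticDatum σ ϖ d t) (h2v : Valued.v (2 : K) < 1)
    (hq : Fintype.card 𝓀[K] = 2) (hE : IsElementDatum σ ϖ N₀ α β n₁ n₂ n₃)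
    (h12 : n₁ = n₂) (hshallow : n₁ + 2 * d = n₃ + 2) (hpar : n₁ % 2 = d % 2)
    {eA eB : K} (hσeA : σ eA = eA) (heA1 : Valued.v eA = 1) (hσeB : σ eB = eB)
    (heA : Valued.v ((ϖ ^ mstarOfRecord d)⁻¹ * ((α - 1) * ((ϖ * σ ϖ) ^ ((n₂ - d % 2) / 2))⁻¹ - eA * ((ϖ - σ ϖ) * ((ϖ * σ ϖ) ^ ((d - d % 2) / 2))⁻¹))) ≤ 1)
    (heB : Valued.v ((ϖ ^ mstarOfRecord d)⁻¹ * ((β - 1) * ((ϖ * σ ϖ) ^ ((n₁ - d % 2) / 2))⁻¹ - eB * ((ϖ - σ ϖ) * ((ϖ * σ ϖ) ^ ((d - d % 2) / 2))⁻¹))) ≤ 1) :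
    normSign σ eB = -normSign σ eA := by
  have hvβα : Valued.v (β - α) = Valued.v ϖ ^ n₃ := by rw [Valuation.map_sub_swap, hE.2.2.2.2.2.2.2.1]
  have hL : n₃ + 2 = n₂ + 2 * d := by omega
  have hpar' : n₂ % 2 = d % 2 := h12 ▸ hpar
  rw [h12] at heB
  exact normSign_towerSign_eq_neg_of_sub_shallow_of_card_two hD h2v hq hvβα hL hpar' hσeA heA1 hσeB heA heB

/-- **`ω_C = −ω_B` AT `q = 2` on the shallow key `n₁ = n₃`, `n₁ + 2d = n₂ + 2`.**  For an element datum `(α, β; n₁, n₂, n₃)` (so `|α − 1| = |ϖ|^{n₂}`), tokens `eB` of `β − 1` at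
depth `n₁` and `eC` of `β − α` at depth `n₃` (★ p860780 `heB` ∕ ★ p860907 `heC` verbatim), `n₁ = n₃ ≡ d (mod 2)`: `normSign σ eC = −normSign σ eB` — §2 RELATION II′.
[cite: Serre1979, Ch. V §3 Prop. 5, Cor. 2–3] [cite: Rogawski1990, §4.9 p. 55] -/
theorem normSign_towerSign_eq_neg_of_isElementDatum_of_shallow₂ (hD : IsRamifiedQuadraticDatum σ ϖ d t) (h2v : Valued.v (2 : K) < 1)
    (hq : Fintype.card 𝓀[K] = 2) (hE : IsElementDatum σ ϖ N₀ α β n₁ n₂ n₃)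
    (h13 : n₁ = n₃) (hshallow : n₁ + 2 * d = n₂ + 2) (hpar : n₁ % 2 = d % 2)
    {eB eC : K} (hσeB : σ eB = eB) (hσeC : σ eC = eC) (heC1 : Valued.v eC = 1)
    (heB : Valued.v ((ϖ ^ mstarOfRecord d)⁻¹ * ((β - 1) * ((ϖ * σ ϖ) ^ ((n₁ - d % 2) / 2))⁻¹ - eB * ((ϖ - σ ϖ) * ((ϖ * σ ϖ) ^ ((d - d % 2) / 2))⁻¹))) ≤ 1)
    (heC : Valued.v ((ϖ ^ mstarOfRecord d)⁻¹ * ((β - α) * ((ϖ * σ ϖ) ^ ((n₃ - d % 2) / 2))⁻¹ - eC * ((ϖ - σ ϖ) * ((ϖ * σ ϖ) ^ ((d - d % 2) / 2))⁻¹))) ≤ 1) :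
    normSign σ eC = -normSign σ eB := by
  have hvα : Valued.v (α - 1) = Valued.v ϖ ^ n₂ := hE.2.2.2.2.2.2.1
  have hL : n₂ + 2 = n₁ + 2 * d := by omega
  rw [← h13] at heC
  exact normSign_towerSign_sub_eq_neg_of_fst_shallow_of_card_two hD h2v hq hvα hL hpar hσeB hσeC heC1 heB heC

/-- **`ω_C = −ω(−1)·ω_A` AT `q = 2` on the shallow key `n₂ = n₃`, `n₂ + 2d = n₁ + 2`.**  For an element datum `(α, β; n₁, n₂, n₃)` (so `|β − 1| = |ϖ|^{n₁}`), tokens `eA` of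
`α − 1` at depth `n₂` and `eC` of `β − α` at depth `n₃` (★ p860780 `heA` ∕ ★ p860907 `heC` verbatim), `n₂ = n₃ ≡ d (mod 2)`: `normSign σ eC = −(normSign σ (−1) · normSign σ eA)`
— §2 RELATION III′. [cite: Serre1979, Ch. V §3 Prop. 5, Cor. 2–3] [cite: Rogawski1990, §4.9 p. 55] -/
theorem normSign_towerSign_eq_neg_of_isElementDatum_of_shallow₁ (hD : IsRamifiedQuadraticDatum σ ϖ d t) (h2v : Valued.v (2 : K) < 1)
    (hq : Fintype.card 𝓀[K] = 2) (hE : IsElementDatum σ ϖ N₀ α β n₁ n₂ n₃)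
    (h23 : n₂ = n₃) (hshallow : n₂ + 2 * d = n₁ + 2) (hpar : n₂ % 2 = d % 2)
    {eA eC : K} (hσeA : σ eA = eA) (heA1 : Valued.v eA = 1) (hσeC : σ eC = eC)
    (heA : Valued.v ((ϖ ^ mstarOfRecord d)⁻¹ * ((α - 1) * ((ϖ * σ ϖ) ^ ((n₂ - d % 2) / 2))⁻¹ - eA * ((ϖ - σ ϖ) * ((ϖ * σ ϖ) ^ ((d - d % 2) / 2))⁻¹))) ≤ 1)
    (heC : Valued.v ((ϖ ^ mstarOfRecord d)⁻¹ * ((β - α) * ((ϖ * σ ϖ) ^ ((n₃ - d % 2) / 2))⁻¹ - eC * ((ϖ - σ ϖ) * ((ϖ * σ ϖ) ^ ((d - d % 2) / 2))⁻¹))) ≤ 1) :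
    normSign σ eC = -(normSign σ (-1 : K) * normSign σ eA) := by
  have hvβ : Valued.v (β - 1) = Valued.v ϖ ^ n₁ := hE.2.2.2.2.2.1
  have hL : n₁ + 2 = n₂ + 2 * d := by omega
  rw [← h23] at heC
  exact normSign_towerSign_sub_eq_neg_mul_of_snd_shallow_of_card_two hD h2v hq hvβ hL hpar hσeA heA1 hσeC heA heC

end ElementDatum

end Summit.HodgeConjecture.HodgeConjecture.Cruxes.H413.F0P3cDyRamTowerSignRelationsShallowCardTwo

end
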